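import Literature.Geometry.Kaehler.CechDeRham
import Literature.Geometry.Kaehler.ManifoldFormsPullback
import Literature.Geometry.Kaehler.OpensExtendReal
import HarnessLib

/-!
# Exactness from Čech–de Rham descent data (Bott–Tu's generalized Mayer–Vietoris principle)

Topic `Literature/Geometry/Kaehler`. The injectivity half of the generalized Mayer–Vietoris
principle for the Čech–de Rham double complex of a finite open cover (R. Bott, L. Tu (1982),
Prop. 8.8: the restriction `r : Ω(M) → C⁰(𝔘, Ω)` induces an isomorphism from de Rham cohomology
to the total cohomology; here `Literature.Algebra.Homology.ADoubleComplex.RowAugmentation.exists_dA_eq_of_colLE`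
with the row exactness `cechDeRham_rowExact` / `cechDeRhamRow_exact` of `CechDeRham.lean`), in the
POINTWISE form in which descent arguments produce their data:

* `mem_localExactForms_univ_of_cechDescent`: if a smooth `(k+2)`-form `x` on a manifold `M`
  covered by finitely many opens `u i` admits forms `γ_{n,b,J}` (`n + b = k + 1`), smooth at the
  points of the finite intersections `u_J`, with `d γ_{0,(i)} = x` on `u_i`,
  `Σ_j (-1)^j γ_{n, J∘σ_j} + (-1)^{n+1} d γ_{n+1, J} = 0` on `u_J` and `Σ_j (-1)^j γ_{k+1, J∘σ_j} = 0`
  on the `(k+3)`-fold intersections — i.e. `r x = D γ` in the total complex — then `x` is exact.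
* `restr_mem_localExactForms_of_cechDescent`: the same for forms on an ambient manifold and a
  finite family of opens `U i` NOT covering it: `x` is exact on `⋃ i, U i` (pass to the open
  submanifold `⋃ i, U i`, then extend the primitive by zero, `MForm.extendOpensReal`).

Everything is proved; no named facts (D-0026). Brick [C₃] of the direct route to Deligne's
*Hodge III*, Cor. 8.2.8 on the tree's compact Kähler carriers
(`Literature/AlgebraicGeometry/HodgeTheory/GysinKernelSplitRationalCore.lean`).

## References

* R. Bott, L. W. Tu, *Differential Forms in Algebraic Topology*, Springer GTM 82 (1982), §8,
  Prop. 8.5 and Prop. 8.8. [BottTu1982Forms]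
* C. A. Weibel, *An Introduction to Homological Algebra* (1994), Lemma 2.7.3. [Weibel1994]
-/

noncomputable section

open scoped Manifold ContDiff Topology
open Set Function Literature.Algebra.Homology
open _root_.Topology

namespace Literature.Geometry.Kaehler

set_option backward.isDefEq.respectTransparency false

/-! ### §1 Exactness on a covered manifold -/

section Covered

variable {E : Type*} [NormedAddCommGroup E] [NormedSpace ℝ E] [FiniteDimensional ℝ E]
  {H : Type*} [TopologicalSpace H] {I : ModelWithCorners ℝ E H}
  {M : Type*} [TopologicalSpace M] [ChartedSpace H M] [IsManifold I ∞ M] [T2Space M]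
  [SigmaCompactSpace M]
  {F : Type*} [NormedAddCommGroup F] [NormedSpace ℝ F]
  {ι : Type*} [Fintype ι]

/-- **Exactness from Čech–de Rham descent data** (Bott–Tu (1982), Prop. 8.8, injectivity of
`r^* : H_dR(M) → H_D(C^•(𝔘, Ω^•))`, in pointwise form): a smooth `(k+2)`-form `x` which is a total
coboundary `r x = D γ` in the Čech–de Rham complex of a finite open cover — `d γ_{0,(i)} = x` on
`u_i`, `δ γ_n + (-1)^{n+1} d γ_{n+1} = 0` on the `u_J`, `δ γ_{k+1} = 0` — is exact.
[cite: BottTu1982Forms, §8, Prop. 8.8] [cite: Weibel1994, Lemma 2.7.3] -/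
theorem mem_localExactForms_univ_of_cechDescent {u : ι → Set M} (hu : ∀ i, IsOpen (u i))
    (hcov : ∀ y, ∃ i, y ∈ u i) {k : ℕ} {x : MForm I M F (k + 2)} (hx : IsSmoothForm x)
    (γ : (n b : ℕ) → (Fin (n + 1) → ι) → MForm I M F b)
    (hγs : ∀ n b, n + b = k + 1 → ∀ J, ∀ y ∈ cechSet u J, (γ n b J).SmoothAt y)
    (h0 : ∀ (J : Fin 1 → ι), ∀ y ∈ cechSet u J, mextDeriv (γ 0 (k + 1) J) y = x y)
    (hE : ∀ n b, n + 1 + b = k + 1 → ∀ (J : Fin (n + 2) → ι), ∀ y ∈ cechSet u J,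
      ∑ j : Fin (n + 2), (-1 : ℝ) ^ (j : ℕ) • γ n (b + 1) (J ∘ Fin.succAbove j) y +
        (-1 : ℝ) ^ (n + 1) • mextDeriv (γ (n + 1) b J) y = 0)
    (hL : ∀ (J : Fin (k + 3) → ι), ∀ y ∈ cechSet u J,
      ∑ j : Fin (k + 3), (-1 : ℝ) ^ (j : ℕ) • γ (k + 1) 0 (J ∘ Fin.succAbove j) y = 0) :
    x ∈ localExactForms I F (isOpen_univ : IsOpen (univ : Set M)) (k + 2) := by
  classical
  obtain ⟨ρ, hρ⟩ := SmoothPartitionOfUnity.exists_isSubordinate I isClosed_univ u hu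
    (fun y _ ↦ mem_iUnion.2 (hcov y))
  have hK : (cechDeRham I F hu).RowExact := cechDeRham_rowExact hu ρ hρ
  have hEx : (cechDeRhamRow I F hu).Exact := cechDeRhamRow_exact hu ρ hρ hcov
  -- the total cochain `γ`, cut off to the `u_J` and placed on the antidiagonal `p + q = k + 1`
  have hwmem : ∀ p q, p + q = k + 1 → ∀ J : Fin (p + 1) → ι,
      (γ p q J).restr (cechSet u J) ∈ smoothFormsOn I F (cechSet u J) q := fun p q h J ↦
    ⟨fun y hy ↦ (MForm.smoothAt_restr_iff (isOpen_cechSet hu J) _ hy).2 (hγs p q h J y hy),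
      fun y hy ↦ MForm.restr_apply_of_notMem _ hy⟩
  let w : ∀ p q, CechForms I F u p q := fun p q J ↦
    if h : p + q = k + 1 then ⟨_, hwmem p q h J⟩ else 0
  have hw_pos : ∀ p q (h : p + q = k + 1) (J : Fin (p + 1) → ι),
      (w p q J : MForm I M F q) = (γ p q J).restr (cechSet u J) := by
    intro p q h J
    simp only [w, dif_pos h]
  have hw_neg : ∀ p q, p + q ≠ k + 1 → w p q = 0 := by
    intro p q h
    funext J
    simp only [w, dif_neg h]
    rfl
  have hw : w ∈ ADoubleComplex.Tn ℝ (k + 1) := fun p q h ↦ hw_neg p q h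
  let a : smoothFormsOn I F (univ : Set M) (k + 2) :=
    ⟨x, by rw [smoothFormsOn_univ]; exact (mem_smoothForms_iff x).2 hx⟩
  have hD : (cechDeRham I F hu).totalD w =
      ADoubleComplex.single 0 (k + 2) ((cechDeRhamRow I F hu).ε (k + 2) a) := by
    funext p q
    cases p with
    | zero =>
      cases q with
      | zero =>
        rw [ADoubleComplex.totalD_apply_zero_zero, ADoubleComplex.single_apply_of_ne_snd (by omega)]
      | succ q =>
        rw [ADoubleComplex.totalD_apply_zero_succ]
        by_cases hq : q = k + 1
        · subst hq
          rw [ADoubleComplex.single_apply_same]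
          funext J
          apply Subtype.ext
          change ((cechd I F hu 0 (k + 1) (w 0 (k + 1))) J : MForm I M F (k + 2)) = _
          rw [cechd_apply, pow_zero, one_smul, coe_localD, coe_cechDeRhamRow_ε, hw_pos 0 (k + 1) (by omega) J]
          funext y
          by_cases hy : y ∈ cechSet u J
          · rw [MForm.restr_apply_of_mem _ hy, MForm.restr_apply_of_mem _ hy,
              mextDeriv_restr_apply (isOpen_cechSet hu J) _ hy, h0 J y hy]
          · rw [MForm.restr_apply_of_notMem _ hy, MForm.restr_apply_of_notMem _ hy]
        · rw [hw_neg 0 q (by omega), map_zero, ADoubleComplex.single_apply_of_ne_snd (by omega)]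
    | succ p =>
      cases q with
      | zero =>
        rw [ADoubleComplex.totalD_apply_succ_zero, ADoubleComplex.single_apply_of_ne_fst (by omega)]
        by_cases hp : p = k + 1
        · subst hp
          funext J
          apply Subtype.ext
          change ((cechδ I F hu (k + 1) 0 (w (k + 1) 0)) J : MForm I M F 0) = 0
          funext y
          by_cases hy : y ∈ cechSet u J
          · rw [coe_cechδ_apply_apply_of_mem hu _ hy]
            have : ∀ j : Fin (k + 3), ((w (k + 1) 0 (J ∘ Fin.succAbove j) : MForm I M F 0)) y =
                γ (k + 1) 0 (J ∘ Fin.succAbove j) y := fun j ↦ by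
              rw [hw_pos (k + 1) 0 (by omega), MForm.restr_apply_of_mem _ (cechSet_subset_comp u J _ hy)]
            simp_rw [this]
            rw [hL J y hy]
            rfl
          · exact (cechδ I F hu (k + 1) 0 (w (k + 1) 0) J).2.2 y hy
        · rw [hw_neg p 0 (by omega), map_zero]
      | succ q =>
        rw [ADoubleComplex.totalD_apply_succ_succ, ADoubleComplex.single_apply_of_ne_fst (by omega)]
        by_cases hpq : p + q + 1 = k + 1
        · funext J
          apply Subtype.ext
          change ((cechδ I F hu p (q + 1) (w p (q + 1))) J : MForm I M F (q + 1)) +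
            ((cechd I F hu (p + 1) q (w (p + 1) q)) J : MForm I M F (q + 1)) = 0
          funext y
          by_cases hy : y ∈ cechSet u J
          · rw [Pi.add_apply, coe_cechδ_apply_apply_of_mem hu _ hy, cechd_apply, Submodule.coe_smul,
              Pi.smul_apply, coe_localD, MForm.restr_apply_of_mem _ hy, hw_pos (p + 1) q (by omega) J,
              mextDeriv_restr_apply (isOpen_cechSet hu J) _ hy]
            have : ∀ j : Fin (p + 2), ((w p (q + 1) (J ∘ Fin.succAbove j) : MForm I M F (q + 1))) y =
                γ p (q + 1) (J ∘ Fin.succAbove j) y := fun j ↦ by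
              rw [hw_pos p (q + 1) (by omega), MForm.restr_apply_of_mem _ (cechSet_subset_comp u J _ hy)]
            simp_rw [this]
            exact hE p q (by omega) J y hy
          · rw [Pi.add_apply, (cechδ I F hu p (q + 1) (w p (q + 1)) J).2.2 y hy,
              (cechd I F hu (p + 1) q (w (p + 1) q) J).2.2 y hy, add_zero]
            rfl
        · rw [hw_neg p (q + 1) (by omega), hw_neg (p + 1) q (by omega), map_zero, map_zero, add_zero]
  obtain ⟨a', ha'⟩ := (cechDeRhamRow I F hu).exists_dA_eq_of_colLE hK hEx (k + 1) (k + 1) a w hw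
    (ADoubleComplex.colLE_of_mem_Tn hw) hD
  exact (mem_localExactForms_succ_iff isOpen_univ).2 ⟨a', congrArg Subtype.val ha'⟩

end Covered

/-! ### §2 Exactness on the union of a finite family of opens of an ambient manifold -/

section Ambient

universe u

variable {E : Type u} [NormedAddCommGroup E] [NormedSpace ℝ E] [FiniteDimensional ℝ E]
  {M : Type u} [TopologicalSpace M] [ChartedSpace E M] [IsManifold 𝓘(ℝ, E) ∞ M] [T2Space M]
  [SecondCountableTopology M] [LocallyCompactSpace M]
  {F : Type*} [NormedAddCommGroup F] [NormedSpace ℝ F]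
  {ι : Type*} [Fintype ι]

/-- **Exactness on `⋃ i, U i` from Čech–de Rham descent data** along a finite family of opens
`U i` of a manifold `M` (Bott–Tu (1982), Prop. 8.8 on the open submanifold `⋃ i, U i`, the
primitive extended by zero): if `d γ_{0,(i)} = x` on `U_i`,
`Σ_j (-1)^j γ_{n, J∘σ_j} + (-1)^{n+1} d γ_{n+1, J} = 0` on `U_J` (`n + 1 + b = k + 1`) and
`Σ_j (-1)^j γ_{k+1, J∘σ_j} = 0` on the `(k+3)`-fold intersections, for forms `γ_{n,b,J}` smooth
at the points of `U_J`, then `x` is exact on `⋃ i, U i`. [cite: BottTu1982Forms, §8, Prop. 8.8] -/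
theorem restr_mem_localExactForms_of_cechDescent {U : ι → Set M} (hU : ∀ i, IsOpen (U i))
    {k : ℕ} {x : MForm 𝓘(ℝ, E) M F (k + 2)} (hx : ∀ y ∈ ⋃ i, U i, x.SmoothAt y)
    (γ : (n b : ℕ) → (Fin (n + 1) → ι) → MForm 𝓘(ℝ, E) M F b)
    (hγs : ∀ n b, n + b = k + 1 → ∀ J, ∀ y ∈ cechSet U J, (γ n b J).SmoothAt y)
    (h0 : ∀ (J : Fin 1 → ι), ∀ y ∈ cechSet U J, mextDeriv (γ 0 (k + 1) J) y = x y)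
    (hE : ∀ n b, n + 1 + b = k + 1 → ∀ (J : Fin (n + 2) → ι), ∀ y ∈ cechSet U J,
      ∑ j : Fin (n + 2), (-1 : ℝ) ^ (j : ℕ) • γ n (b + 1) (J ∘ Fin.succAbove j) y +
        (-1 : ℝ) ^ (n + 1) • mextDeriv (γ (n + 1) b J) y = 0)
    (hL : ∀ (J : Fin (k + 3) → ι), ∀ y ∈ cechSet U J,
      ∑ j : Fin (k + 3), (-1 : ℝ) ^ (j : ℕ) • γ (k + 1) 0 (J ∘ Fin.succAbove j) y = 0) :
    x.restr (⋃ i, U i) ∈ localExactForms 𝓘(ℝ, E) F (isOpen_iUnion hU) (k + 2) := by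
  set Ω : TopologicalSpace.Opens M := ⟨⋃ i, U i, isOpen_iUnion hU⟩ with hΩdef
  have hΩ : ((Ω : Set M)) = ⋃ i, U i := rfl
  rcases isEmpty_or_nonempty Ω with hΩe | ⟨⟨w₀⟩⟩
  · have he : (⋃ i, U i) = ∅ := by
      rw [← hΩ]
      exact Set.isEmpty_coe_sort.1 hΩe
    have : x.restr (⋃ i, U i) = 0 := by
      funext m
      exact MForm.restr_apply_of_notMem _ (by rw [he]; exact notMem_empty m)
    rw [this]
    exact zero_mem _
  haveI : LocallyCompactSpace Ω := (isOpen_iUnion hU).locallyCompactSpace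
  let u : ι → Set Ω := fun i ↦ Subtype.val ⁻¹' U i
  have hu : ∀ i, IsOpen (u i) := fun i ↦ (hU i).preimage continuous_subtype_val
  have hcov : ∀ y : Ω, ∃ i, y ∈ u i := fun y ↦ by
    obtain ⟨i, hi⟩ := mem_iUnion.1 (show (y : M) ∈ ⋃ i, U i from y.2)
    exact ⟨i, hi⟩
  have hcs : ∀ {n : ℕ} (J : Fin n → ι) (y : Ω), y ∈ cechSet u J ↔ (y : M) ∈ cechSet U J := by
    intro n J y
    simp only [mem_cechSet_iff, u, mem_preimage]
  set x' := x.pullback 𝓘(ℝ, E) (Subtype.val : Ω → M) with hx'def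
  have hx' : IsSmoothForm x' :=
    (isSmoothForm_iff_smoothAt _).2 fun y ↦ MForm.SmoothAt.pullback_subtypeVal (hx y y.2)
  let γ' : (n b : ℕ) → (Fin (n + 1) → ι) → MForm 𝓘(ℝ, E) Ω F b := fun n b J ↦
    (γ n b J).pullback 𝓘(ℝ, E) Subtype.val
  have key := mem_localExactForms_univ_of_cechDescent (I := 𝓘(ℝ, E)) hu hcov hx' γ' ?_ ?_ ?_ ?_
  · obtain ⟨a', ha'⟩ := (mem_localExactForms_succ_iff isOpen_univ).1 key
    let β : MForm 𝓘(ℝ, E) M F (k + 1) := MForm.extendOpensReal (a' : MForm 𝓘(ℝ, E) Ω F (k + 1)) w₀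
    have hβ : β ∈ smoothFormsOn 𝓘(ℝ, E) F (Ω : Set M) (k + 1) :=
      ⟨fun m hm ↦ MForm.smoothAt_extendOpensReal hm (a'.2.1 _ (mem_univ _)),
        fun m hm ↦ MForm.extendOpensReal_apply_of_notMem _ hm⟩
    refine (mem_localExactForms_succ_iff _).2 ⟨⟨β, hβ⟩, ?_⟩
    rw [coe_localD]
    funext m
    by_cases hm : m ∈ ⋃ i, U i
    · rw [MForm.restr_apply_of_mem _ hm, MForm.restr_apply_of_mem _ hm]
      have hsm : β.SmoothAt m := hβ.1 m hm
      have e2 : mextDeriv (a' : MForm 𝓘(ℝ, E) Ω F (k + 1)) = x' := by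
        rw [← MForm.restr_univ (mextDeriv _), ← coe_localD isOpen_univ a', ha']
      ext v
      have e1 := mextDeriv_pullback_subtypeVal_apply (U := Ω) (x := ⟨m, hm⟩) hsm v
      rw [MForm.pullback_subtypeVal_extendOpensReal, e2] at e1
      rw [← e1]
      exact MForm.pullback_subtypeVal_apply x ⟨m, hm⟩ v
    · rw [MForm.restr_apply_of_notMem _ hm, MForm.restr_apply_of_notMem _ hm]
  · intro n b h J y hy
    exact MForm.SmoothAt.pullback_subtypeVal (hγs n b h J y ((hcs J y).1 hy))
  · intro J y hy
    have hyM := (hcs J y).1 hy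
    ext v
    rw [mextDeriv_pullback_subtypeVal_apply (hγs 0 (k + 1) (by omega) J _ hyM) v,
      MForm.pullback_subtypeVal_apply, h0 J _ hyM]
  · intro n b h J y hy
    have hyM := (hcs J y).1 hy
    ext v
    have h1 := congrArg (fun φ ↦ φ v) (hE n b h J _ hyM)
    simp only [ContinuousAlternatingMap.add_apply, ContinuousAlternatingMap.sum_apply,
      ContinuousAlternatingMap.smul_apply, ContinuousAlternatingMap.coe_zero, Pi.zero_apply] at h1 ⊢
    rw [mextDeriv_pullback_subtypeVal_apply (hγs (n + 1) b (by omega) J _ hyM) v]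
    simp only [γ', MForm.pullback_subtypeVal_apply]
    exact h1
  · intro J y hy
    have hyM := (hcs J y).1 hy
    ext v
    have h1 := congrArg (fun φ ↦ φ v) (hL J _ hyM)
    simp only [ContinuousAlternatingMap.sum_apply, ContinuousAlternatingMap.smul_apply,
      ContinuousAlternatingMap.coe_zero, Pi.zero_apply] at h1 ⊢
    simp only [γ', MForm.pullback_subtypeVal_apply]
    exact h1

end Ambient

end Literature.Geometry.Kaehler

end
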